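import Mathlib
import Summits.ValiantsHypothesis.ValiantsHypothesis.Theorems.KPlusLogSqLawWeakLiftingTowerGraftSkewBlockCrossings
import Summits.ValiantsHypothesis.ValiantsHypothesis.Theorems.KPlusLogSqLawWeakLiftingTowerGraftSkewBlockIdentityGraftSixThree
import Literature.Combinatorics.SimpleGraph.VertexDeletedCharpoly

/-!
# Tower graft line — THE SKEW-BLOCK FAMILY UNDER THE IDENTITY GRAFT CROSSES TWICE AT EVERY ROOT OF `det B` (S4's object; the
# qualitative half, all sizes — companion of p689545 `…SkewBlockCrossings` for the corner graft)

Calibration file for the line `Cruxes/WeakLifting/Lines/tower_graft.lean` (crux `WeakLifting` = stmt-ValiantsHypothesis-19561), for the object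
of S4 `stub_graftLawId` (far letter the FULL identity, `det(G + X^D·1)`).  NO stub is claimed.  It shows that the S4b-side and the S4-side
no-go rows of the ledger are ONE MECHANISM: **from exactly the hypotheses of p689545's `skewBlock_phantoms_square`** (square blocks
`B(t) = Σₗ t^{dₗ}Bₗ`, interleaved positive points `τ₀ < ρ₀ < ⋯ < ρ_{N−1} < τ_N` with `det B(τᵢ) ≠ 0`, `det B(ρᵢ) = 0`, `B″(ρᵢ)` of full column
rank) plus `τ_N < 1`, for every sufficiently large far exponent `D` some `η > 0` gives

* `skewBlock_identity_crossings` — `Z₊(det G_η) = 0` (p688917) **and `Z₊(det(G_η + X^D·1)) ≥ 2N`**.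

MECHANISM.  By Schur for scalar blocks (`det_fromBlocks_smul_one`, p699141) `det(G_η(t) + t^D·1) = det(σ(t)·1 − B(t)ᵀB(t)) = χ_{BᵀB(t)}(σ(t))`
(`det_smul_one_sub_eq_eval_charpoly`) with `σ(t) = (ηt^{d_{l₀}} + t^D)(t^D − ηt^{d_{l₀}}) = t^{2D} − η²t^{2d_{l₀}}`; choosing `τ_N^D < δ`, `D ≥ d_{l₀}`
and `η = τ₀^D/2` puts `σ(t) ∈ (0, δ)` at every certificate point.  At `τᵢ`: `χ(0) = (−1)^{q+1}(det B)² ≠ 0`, sign persistence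
(`exists_pos_forall_eval_neg`, p689545).  At `ρᵢ`: `χ(0) = 0` (`Matrix.det_eq_sign_charpoly_coeff`) and
`(−1)^q χ'(0) = Σ_c det((BᵀB)^{(c)}) > 0` (`charpoly_gram_coeff_one_pos`: the tree's `derivative_charpoly = Σ charpoly of principal submatrices`
(`Literature…VertexDeletedCharpoly`), principal minors of a PSD matrix `≥ 0` (`PosSemidef.submatrix`), the `j`-th one `= det B″ᵀB″ ≠ 0`
via `finSuccAboveEquiv`), first-order positivity (`exists_pos_forall_eval_pos_of_coeff`).  Then the interleaved IVT certificate of p689545.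
READING: every datum that feeds p689545 (the (4,3) instance p691223, the bidiagonal families p692037/p693809, the Descartes-rich (6,3) block
p697262 and the scaled copies p698688) yields identity-graft phantoms as well, with NO eigenvalue event of the base pencil (|λ| ≥ η|t|^{d_{l₀}});
kernel, qualitative (`∃ D₀ ∀ D ≥ D₀`), like p689545.  HONEST FRAMING: linear algebra + one-variable sign persistence; nothing on S4/S4b/S5/S5ᴸ,
TowerB, `WeakLifting`, Conjecture B, `MatrixDescartes` (18050) or `VP ≠ VNP`.  Def-free.  Seat: prover val-sym-lift-p2 g20, `--supports 19561`.
-/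

-- `Summit.ValiantsHypothesis.ValiantsHypothesis.…` repeats a component by the D-0017 layout
-- (single-conjunct summit), which the `dupNamespace` linter flags; the name is mandated.
set_option linter.dupNamespace false

namespace Summit.ValiantsHypothesis.ValiantsHypothesis.Theorems.KPlusLogSqLaw.TowerGraft

open Polynomial Matrix
open scoped BigOperators Polynomial

section IdentityCrossings

/-- `det (s·1 − P) = χ_P(s)`. [folklore] -/
theorem det_smul_one_sub_eq_eval_charpoly {n : Type*} [Fintype n] [DecidableEq n] (P : Matrix n n ℝ) (s : ℝ) :
    (s • (1 : Matrix n n ℝ) - P).det = P.charpoly.eval s := by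
  rw [Matrix.eval_charpoly, Matrix.smul_one_eq_diagonal]
  rfl

/-- at a root: `(−1)^q · (χ_{BᵀB})₁ = Σ_i det((BᵀB)^{(i)}) > 0` as soon as one column-deleted Gram determinant is non-zero
(every term is a principal minor of a positive semidefinite matrix). [this work] -/
theorem charpoly_gram_coeff_one_pos {q : ℕ} (B : Matrix (Fin (q + 1)) (Fin (q + 1)) ℝ) (j : Fin (q + 1))
    (hj : ((B.submatrix id j.succAbove)ᵀ * B.submatrix id j.succAbove).det ≠ 0) :
    0 < (-1 : ℝ) ^ q * (Bᵀ * B).charpoly.coeff 1 := by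
  set P : Matrix (Fin (q + 1)) (Fin (q + 1)) ℝ := Bᵀ * B with hP
  have hPsd : P.PosSemidef := by
    simpa [hP, Matrix.conjTranspose_eq_transpose_of_trivial] using Matrix.posSemidef_conjTranspose_mul_self B
  have hcoeff : P.charpoly.coeff 1 = (derivative P.charpoly).eval 0 := by
    rw [← coeff_zero_eq_eval_zero, coeff_derivative]; simp
  rw [hcoeff, Literature.Combinatorics.SimpleGraph.VertexDeletedCharpoly.eval_derivative_charpoly_eq_sum P (0 : ℝ), Finset.mul_sum]
  have hterm : ∀ i : Fin (q + 1), (-1 : ℝ) ^ q *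
      ((P.submatrix (Subtype.val : {a // a ≠ i} → Fin (q + 1)) Subtype.val).charpoly).eval 0 =
      (P.submatrix (Subtype.val : {a // a ≠ i} → Fin (q + 1)) Subtype.val).det := by
    intro i
    rw [← det_smul_one_sub_eq_eval_charpoly, zero_smul, zero_sub, Matrix.det_neg]
    have hcard : Fintype.card {a // a ≠ i} = q := by
      rw [Fintype.card_subtype_compl, Fintype.card_fin]; simp
    rw [hcard, ← mul_assoc, ← mul_pow, neg_one_mul, neg_neg, one_pow, one_mul]
  have hnonneg : ∀ i : Fin (q + 1), 0 ≤ (-1 : ℝ) ^ q *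
      ((P.submatrix (Subtype.val : {a // a ≠ i} → Fin (q + 1)) Subtype.val).charpoly).eval 0 := by
    intro i; rw [hterm]; exact (hPsd.submatrix _).det_nonneg
  have hjpos : 0 < (-1 : ℝ) ^ q *
      ((P.submatrix (Subtype.val : {a // a ≠ j} → Fin (q + 1)) Subtype.val).charpoly).eval 0 := by
    rw [hterm]
    refine lt_of_le_of_ne (hPsd.submatrix _).det_nonneg (Ne.symm ?_)
    -- re-index `{a // a ≠ j}` by `Fin q` through `finSuccAboveEquiv j`
    have hre : (P.submatrix (Subtype.val : {a // a ≠ j} → Fin (q + 1)) Subtype.val).det =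
        ((B.submatrix id j.succAbove)ᵀ * B.submatrix id j.succAbove).det := by
      rw [← Matrix.det_submatrix_equiv_self (finSuccAboveEquiv j)]
      congr 1
    rw [hre]; exact hj
  calc (0 : ℝ) < _ := hjpos
    _ ≤ ∑ i, (-1 : ℝ) ^ q * ((P.submatrix (Subtype.val : {a // a ≠ i} → Fin (q + 1)) Subtype.val).charpoly).eval 0 :=
        Finset.single_le_sum (fun i _ => hnonneg i) (Finset.mem_univ j)

/-- **THE SKEW-BLOCK FAMILY UNDER THE IDENTITY GRAFT CROSSES TWICE AT EVERY ROOT OF `det B` (S4's object; qualitative half, all sizes).**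
Same data as `skewBlock_phantoms_square` (p689545): square blocks `B(t) = Σₗ t^{dₗ} Bₗ`, points `τ₀ < ρ₀ < τ₁ < ⋯ < ρ_{N−1} < τ_N < 1` with
`det B(τᵢ) ≠ 0`, `det B(ρᵢ) = 0` and `B″(ρᵢ)` (column `j` deleted) of full column rank.  Then for all sufficiently large far exponents `D`
some `η > 0` makes the FULL-IDENTITY graft `det(G_η + X^D·1)` have at least `2N` distinct positive roots, while `det G_η` has none
(mechanism: `det(G_η(t) + t^D·1) = det(σ(t)·1 − B(t)ᵀB(t))`, `σ(t) = t^{2D} − η²t^{2d_{l₀}} ∈ (0, δ)`; at `τᵢ` the sign is `(−1)^{q+1}`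
(sign persistence of `χ_{BᵀB}` at `0`), at `ρᵢ` it is `(−1)^q` (`χ_{BᵀB}(0) = 0 < (−1)^q χ'_{BᵀB}(0) = Σ_c det B‴_cᵀB‴_c`)). [this work] -/
theorem skewBlock_identity_crossings {q K : ℕ} (d : Fin K → ℕ) (l₀ : Fin K) (B : Fin K → Matrix (Fin (q + 1)) (Fin (q + 1)) ℝ)
    (j : Fin (q + 1)) (N : ℕ) (τ ρ : ℕ → ℝ) (hτρ : ∀ i, τ i < ρ i) (hρτ : ∀ i, ρ i < τ (i + 1)) (hτpos : ∀ i, 0 < τ i)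
    (hτN : τ N < 1)
    (hτB : ∀ i, i ≤ N → (∑ l, τ i ^ d l • B l).det ≠ 0)
    (hρB : ∀ i, i < N → (∑ l, ρ i ^ d l • B l).det = 0)
    (hρB'' : ∀ i, i < N → (((∑ l, ρ i ^ d l • B l).submatrix id j.succAbove)ᵀ *
      ((∑ l, ρ i ^ d l • B l).submatrix id j.succAbove)).det ≠ 0) :
    ∃ D₀ : ℕ, ∀ D : ℕ, D₀ ≤ D → ∃ η : ℝ, 0 < η ∧
      ((∑ l, (X : ℝ[X]) ^ d l • (Matrix.fromBlocks (if l = l₀ then η • (1 : Matrix (Fin (q + 1)) (Fin (q + 1)) ℝ) else 0) (B l)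
        (B l)ᵀ (if l = l₀ then -(η • (1 : Matrix (Fin (q + 1)) (Fin (q + 1)) ℝ)) else 0)).map C).det.roots.toFinset.filter
        (fun t => 0 < t)).card = 0 ∧
      2 * N ≤ (((∑ l, (X : ℝ[X]) ^ d l • (Matrix.fromBlocks (if l = l₀ then η • (1 : Matrix (Fin (q + 1)) (Fin (q + 1)) ℝ) else 0)
          (B l) (B l)ᵀ (if l = l₀ then -(η • (1 : Matrix (Fin (q + 1)) (Fin (q + 1)) ℝ)) else 0)).map C) +
        (X : ℝ[X]) ^ D • (1 : Matrix (Fin (q + 1) ⊕ Fin (q + 1)) (Fin (q + 1) ⊕ Fin (q + 1)) ℝ[X])).det.roots.toFinset.filter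
        (fun t => 0 < t)).card := by
  classical
  set Bt : ℝ → Matrix (Fin (q + 1)) (Fin (q + 1)) ℝ := fun t => ∑ l, t ^ d l • B l with hBt
  set P : ℝ → Matrix (Fin (q + 1)) (Fin (q + 1)) ℝ := fun t => (Bt t)ᵀ * Bt t with hPdef
  set Ψ : ℝ → ℝ[X] := fun t => C ((-1 : ℝ) ^ q) * (P t).charpoly with hΨ
  have hΨeval : ∀ t σ : ℝ, (σ • (1 : Matrix (Fin (q + 1)) (Fin (q + 1)) ℝ) - P t).det = (-1 : ℝ) ^ q * (Ψ t).eval σ := by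
    intro t σ
    simp only [hΨ, eval_mul, eval_C, det_smul_one_sub_eq_eval_charpoly]
    rw [← mul_assoc, ← mul_pow, neg_one_mul, neg_neg, one_pow, one_mul]
  -- thresholds in `σ`
  have Hτ : ∀ i, ∃ s₀ : ℝ, 0 < s₀ ∧ (i ≤ N → ∀ s, 0 < s → s < s₀ → (Ψ (τ i)).eval s < 0) := by
    intro i
    by_cases hi : i ≤ N
    · have hdetP : 0 < (P (τ i)).det := by
        have : (P (τ i)).det = (Bt (τ i)).det ^ 2 := by simp only [hPdef, Matrix.det_mul, Matrix.det_transpose, sq]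
        rw [this]; exact lt_of_le_of_ne (sq_nonneg _) (Ne.symm (pow_ne_zero 2 (hτB i hi)))
      have h0 : (Ψ (τ i)).eval 0 < 0 := by
        have h1 := hΨeval (τ i) 0
        rw [zero_smul, zero_sub, Matrix.det_neg, Fintype.card_fin] at h1
        -- `(−1)^{q+1} det P = (−1)^q Ψ(0)` ⇒ `Ψ(0) = −det P`
        have : (Ψ (τ i)).eval 0 = -(P (τ i)).det := by
          have e : ((-1 : ℝ) ^ q) * ((-1 : ℝ) ^ q) = 1 := by rw [← mul_pow, neg_one_mul, neg_neg, one_pow]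
          calc (Ψ (τ i)).eval 0 = ((-1 : ℝ) ^ q * (-1) ^ q) * (Ψ (τ i)).eval 0 := by rw [e, one_mul]
            _ = (-1 : ℝ) ^ q * ((-1 : ℝ) ^ (q + 1) * (P (τ i)).det) := by rw [mul_assoc, ← h1]
            _ = -(P (τ i)).det := by rw [pow_succ, ← mul_assoc, ← mul_assoc, e, one_mul, neg_one_mul]
        rw [this]; exact neg_neg_of_pos hdetP
      obtain ⟨s₀, h1, h2⟩ := exists_pos_forall_eval_neg _ h0
      exact ⟨s₀, h1, fun _ => h2⟩
    · exact ⟨1, one_pos, fun h => absurd h hi⟩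
  have Hρ : ∀ i, ∃ s₀ : ℝ, 0 < s₀ ∧ (i < N → ∀ s, 0 < s → s < s₀ → 0 < (Ψ (ρ i)).eval s) := by
    intro i
    by_cases hi : i < N
    · have h0 : (Ψ (ρ i)).coeff 0 = 0 := by
        have hd : (P (ρ i)).det = 0 := by simp only [hPdef, Matrix.det_mul, Matrix.det_transpose, hBt, hρB i hi, mul_zero]
        have := Matrix.det_eq_sign_charpoly_coeff (P (ρ i))
        rw [hd, Fintype.card_fin] at this
        simp only [hΨ, coeff_C_mul]
        have hc : (P (ρ i)).charpoly.coeff 0 = 0 := by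
          rcases mul_eq_zero.mp this.symm with h | h
          · exact absurd h (pow_ne_zero _ (by norm_num))
          · exact h
        rw [hc, mul_zero]
      have h1 : 0 < (Ψ (ρ i)).coeff 1 := by
        simp only [hΨ, coeff_C_mul]
        exact charpoly_gram_coeff_one_pos (Bt (ρ i)) j (hρB'' i hi)
      obtain ⟨s₀, h2, h3⟩ := exists_pos_forall_eval_pos_of_coeff _ h0 h1
      exact ⟨s₀, h2, fun _ => h3⟩
    · exact ⟨1, one_pos, fun h => absurd h hi⟩
  choose sτ hsτ hτneg using Hτ
  choose sρ hsρ hρpos' using Hρ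
  set Sδ : Finset ℝ := (Finset.range (N + 1)).image sτ ∪ (Finset.range N).image sρ with hSδ
  have hSne : Sδ.Nonempty := ⟨sτ 0, Finset.mem_union_left _ (Finset.mem_image.mpr ⟨0, Finset.mem_range.mpr (Nat.succ_pos N), rfl⟩)⟩
  set δ := Sδ.min' hSne with hδ
  have hδpos : 0 < δ := by
    rw [hδ, Finset.lt_min'_iff]
    intro y hy
    rcases Finset.mem_union.mp hy with hy | hy
    · obtain ⟨i, -, rfl⟩ := Finset.mem_image.mp hy; exact hsτ i
    · obtain ⟨i, -, rfl⟩ := Finset.mem_image.mp hy; exact hsρ i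
  have hδτ : ∀ i, i ≤ N → δ ≤ sτ i := fun i hi =>
    Finset.min'_le _ _ (Finset.mem_union_left _ (Finset.mem_image.mpr ⟨i, Finset.mem_range.mpr (Nat.lt_succ_of_le hi), rfl⟩))
  have hδρ : ∀ i, i < N → δ ≤ sρ i := fun i hi =>
    Finset.min'_le _ _ (Finset.mem_union_right _ (Finset.mem_image.mpr ⟨i, Finset.mem_range.mpr hi, rfl⟩))
  -- the far exponent: `τ_N^D < δ` and `D ≥ d l₀`
  obtain ⟨n, hn⟩ := exists_pow_lt_of_lt_one hδpos hτN
  refine ⟨max n (d l₀), fun D hD => ?_⟩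
  have hDn : n ≤ D := le_trans (le_max_left _ _) hD
  have hDl : d l₀ ≤ D := le_trans (le_max_right _ _) hD
  -- all certificate points lie in `[τ 0, τ N]`
  set f : ℕ → ℝ := fun m => if m % 2 = 0 then τ (m / 2) else ρ (m / 2) with hf
  have hf_even : ∀ m : ℕ, m % 2 = 0 → f m = τ (m / 2) := fun m hm => by simp only [hf, if_pos hm]
  have hf_odd : ∀ m : ℕ, ¬ m % 2 = 0 → f m = ρ (m / 2) := fun m hm => by simp only [hf, if_neg hm]
  have hf_succ : ∀ m : ℕ, f m < f (m + 1) := by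
    intro m
    by_cases hm : m % 2 = 0
    · rw [hf_even m hm, hf_odd (m + 1) (by omega), show (m + 1) / 2 = m / 2 by omega]; exact hτρ _
    · rw [hf_odd m hm, hf_even (m + 1) (by omega), show (m + 1) / 2 = m / 2 + 1 by omega]; exact hρτ _
  have hf_mono : StrictMono f := strictMono_nat_of_lt_succ hf_succ
  have hf_range : ∀ m, m ≤ 2 * N → τ 0 ≤ f m ∧ f m ≤ τ N := by
    intro m hm
    have h0 : f 0 = τ 0 := hf_even 0 (by norm_num)
    have hN' : f (2 * N) = τ N := by rw [hf_even (2 * N) (by omega), show 2 * N / 2 = N by omega]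
    exact ⟨h0 ▸ hf_mono.monotone (Nat.zero_le m), hN' ▸ hf_mono.monotone hm⟩
  have hτ0lt1 : τ 0 < 1 := lt_of_le_of_lt ((hf_range 0 (Nat.zero_le _)).2 |>.trans_eq' (hf_even 0 (by norm_num)).symm |> fun h => by
    have := (hf_range 0 (Nat.zero_le _)).2; rw [hf_even 0 (by norm_num)] at this; exact this) hτN
  -- `η` and `σ(t)`
  set η : ℝ := τ 0 ^ D / 2 with hη
  have hηpos : 0 < η := by rw [hη]; exact div_pos (pow_pos (hτpos 0) D) two_pos
  set σ : ℝ → ℝ := fun t => (η * t ^ d l₀ + t ^ D) * (t ^ D - η * t ^ d l₀) with hσ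
  have hσbounds : ∀ t, τ 0 ≤ t → t ≤ τ N → 0 < σ t ∧ σ t < δ := by
    intro t ht0 ht1
    have htpos : 0 < t := (hτpos 0).trans_le ht0
    have ht1' : t < 1 := ht1.trans_lt hτN
    have hlow : η * t ^ d l₀ < t ^ D := by
      obtain ⟨e, he⟩ : ∃ e, D = d l₀ + e := ⟨D - d l₀, by omega⟩
      rw [he, pow_add]
      have h1 : τ 0 ^ D ≤ τ 0 ^ e := pow_le_pow_of_le_one (hτpos 0).le hτ0lt1.le (by omega)
      have h2 : τ 0 ^ e ≤ t ^ e := pow_le_pow_left₀ (hτpos 0).le ht0 e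
      have h3 : 0 < t ^ d l₀ := pow_pos htpos _
      have h4 : η < t ^ e := by rw [hη]; linarith [pow_pos (hτpos 0) D]
      nlinarith
    constructor
    · simp only [hσ]; exact mul_pos (by positivity) (by linarith)
    · have hup : σ t ≤ t ^ D * t ^ D := by
        simp only [hσ]; nlinarith [pow_pos htpos D, mul_pos hηpos (pow_pos htpos (d l₀))]
      have h5 : t ^ D * t ^ D = t ^ (2 * D) := by rw [← pow_add]; ring_nf
      have h6 : t ^ (2 * D) ≤ τ N ^ (2 * D) := pow_le_pow_left₀ htpos.le ht1 _
      have h7 : τ N ^ (2 * D) ≤ τ N ^ n := pow_le_pow_of_le_one ((hτpos N).le) hτN.le (by omega)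
      linarith
  refine ⟨η, hηpos, card_posRoots_det_skewBlock_pencil_eq_zero d l₀ hηpos.ne' B, ?_⟩
  -- the graft at `t`
  set h : ℝ[X] := ((∑ l, (X : ℝ[X]) ^ d l • (Matrix.fromBlocks (if l = l₀ then η • (1 : Matrix (Fin (q + 1)) (Fin (q + 1)) ℝ) else 0)
      (B l) (B l)ᵀ (if l = l₀ then -(η • (1 : Matrix (Fin (q + 1)) (Fin (q + 1)) ℝ)) else 0)).map C) +
      (X : ℝ[X]) ^ D • (1 : Matrix (Fin (q + 1) ⊕ Fin (q + 1)) (Fin (q + 1) ⊕ Fin (q + 1)) ℝ[X])).det with hh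
  have hgraft : ∀ t : ℝ, 0 < t → h.eval t = (-1 : ℝ) ^ q * (Ψ t).eval (σ t) := by
    intro t ht
    rw [hh, eval_det_pencil_add_pow_one, skewBlock_pencil_eval, ← Matrix.fromBlocks_one, Matrix.fromBlocks_smul, Matrix.fromBlocks_add]
    have hα : η * t ^ d l₀ + t ^ D ≠ 0 := by positivity
    have e1 : (η * t ^ d l₀) • (1 : Matrix (Fin (q + 1)) (Fin (q + 1)) ℝ) + t ^ D • (1 : Matrix (Fin (q + 1)) (Fin (q + 1)) ℝ) =
        (η * t ^ d l₀ + t ^ D) • (1 : Matrix (Fin (q + 1)) (Fin (q + 1)) ℝ) := by rw [add_smul]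
    have e2 : -((η * t ^ d l₀) • (1 : Matrix (Fin (q + 1)) (Fin (q + 1)) ℝ)) + t ^ D • (1 : Matrix (Fin (q + 1)) (Fin (q + 1)) ℝ) =
        (t ^ D - η * t ^ d l₀) • (1 : Matrix (Fin (q + 1)) (Fin (q + 1)) ℝ) := by rw [sub_smul]; abel
    rw [smul_zero, add_zero, add_zero, e1, e2, det_fromBlocks_smul_one _ _ hα, ← hΨeval]
  have hprod : ∀ t₁ t₂ : ℝ, 0 < t₁ → 0 < t₂ → (Ψ t₁).eval (σ t₁) * (Ψ t₂).eval (σ t₂) < 0 → h.eval t₁ * h.eval t₂ < 0 := by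
    intro t₁ t₂ ht₁ ht₂ hlt
    rw [hgraft t₁ ht₁, hgraft t₂ ht₂]
    have e : ((-1 : ℝ) ^ q) * ((-1 : ℝ) ^ q) = 1 := by rw [← mul_pow, neg_one_mul, neg_neg, one_pow]
    calc (-1 : ℝ) ^ q * (Ψ t₁).eval (σ t₁) * ((-1 : ℝ) ^ q * (Ψ t₂).eval (σ t₂))
        = (((-1 : ℝ) ^ q) * ((-1 : ℝ) ^ q)) * ((Ψ t₁).eval (σ t₁) * (Ψ t₂).eval (σ t₂)) := by ring
      _ < 0 := by rw [e, one_mul]; exact hlt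
  -- signs at the certificate points
  have hnegτ : ∀ i, i ≤ N → (Ψ (τ i)).eval (σ (τ i)) < 0 := by
    intro i hi
    have hr := hf_range (2 * i) (by omega)
    rw [hf_even (2 * i) (by omega), show 2 * i / 2 = i by omega] at hr
    obtain ⟨hs0, hs1⟩ := hσbounds (τ i) hr.1 hr.2
    exact hτneg i hi _ hs0 (hs1.trans_le (hδτ i hi))
  have hposρ : ∀ i, i < N → 0 < (Ψ (ρ i)).eval (σ (ρ i)) := by
    intro i hi
    have hr := hf_range (2 * i + 1) (by omega)
    rw [hf_odd (2 * i + 1) (by omega), show (2 * i + 1) / 2 = i by omega] at hr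
    obtain ⟨hs0, hs1⟩ := hσbounds (ρ i) hr.1 hr.2
    exact hρpos' i hi _ hs0 (hs1.trans_le (hδρ i hi))
  have hf_pos : ∀ m, 0 < f m := by
    intro m
    by_cases hm : m % 2 = 0
    · rw [hf_even m hm]; exact hτpos _
    · rw [hf_odd m hm]; exact (hτpos _).trans (hτρ _)
  have hf_alt : ∀ m : ℕ, m + 1 ≤ 2 * N → h.eval (f m) * h.eval (f (m + 1)) < 0 := by
    intro m hm
    refine hprod _ _ (hf_pos m) (hf_pos (m + 1)) ?_
    by_cases hpar : m % 2 = 0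
    · rw [hf_even m hpar, hf_odd (m + 1) (by omega), show (m + 1) / 2 = m / 2 by omega]
      exact mul_neg_of_neg_of_pos (hnegτ _ (by omega)) (hposρ _ (by omega))
    · rw [hf_odd m hpar, hf_even (m + 1) (by omega), show (m + 1) / 2 = m / 2 + 1 by omega]
      exact mul_neg_of_pos_of_neg (hposρ _ (by omega)) (hnegτ _ (by omega))
  have hcnt := Summit.ValiantsHypothesis.ValiantsHypothesis.Theorems.SymmetroidDescartes.le_card_posRoots_of_alternating h (2 * N)
    (fun i => f (i : ℕ)) (fun a b hab => hf_mono hab) (fun i => hf_pos i) (fun i => by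
      have e1 : ((Fin.castSucc i : Fin (2 * N + 1)) : ℕ) = (i : ℕ) := rfl
      have e2 : ((Fin.succ i : Fin (2 * N + 1)) : ℕ) = (i : ℕ) + 1 := rfl
      simp only [e1, e2]
      exact hf_alt i (by omega))
  simpa [hh] using hcnt

end IdentityCrossings

end Summit.ValiantsHypothesis.ValiantsHypothesis.Theorems.KPlusLogSqLaw.TowerGraft
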